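import Summits.Ventures.LatticeQCDFlow.Exactness.Phi4FlowSquareIntegrableCeiling
import HarnessLib

/-!
# The third use of a flow: von Neumann REJECTION SAMPLING with an envelope `e^{−S} ≤ C q̃` — per model
# draw, reweighting is never worse (`σ²_RW ≤ (C/Z)·Var`), and the exact chain is less than twice worse
# (`σ²_chain ≤ (2C/Z − 1)·Var < 2(C/Z)·Var`)

HONEST FRAMING: exact (Metropolis-corrected) sampling algorithms for lattice gauge theory;
figures of merit are autocorrelation/cost numbers at stated couplings and volumes; no
continuum-physics claim.  (SCALAR calibration rung S0-A: not a gauge result.)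

Venture `LatticeQCDFlow` (cell pub-lqcd), topic `Exactness`; FANOUT row 2 (`s0-phi4`, FLOW arm).
NEW WORK of the cell (a pointwise bound and the tree's weight-bound ceiling; nothing is cited as a
fact; no definition).  Printed counterpart NAMED ONLY: J. S. Liu, *Metropolized independent sampling
with comparisons to rejection sampling and importance sampling*, Statistics and Computing 6 (1996).
When an ENVELOPE constant is known, `w = e^{−S} ≤ C q̃` pointwise, a trained flow has a third
classical use besides the exact chain and reweighting (this generation's files #1–#9): von Neumann
rejection sampling — accept a model draw `y` with probability `w(y)/(C q̃(y))`, producing exactly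
distributed INDEPENDENT configurations at the rate `Z/C` per model draw, hence (standard, NOT typed:
the binomial thinning of the i.i.d. stream) a limiting `N·variance` of `(C/Z)·Var_π(g)` per model draw
for every `g ∈ L²(π)`.  Against that benchmark `σ²_rej(g) = (C/Z)·Var_π(g)`:

* REWEIGHTING is never worse: `σ²_RW(g) = Z⁻²∫ g² b w ≤ (C/Z)·(∫ g² w)/Z = σ²_rej(g)` (`b ≤ C`
  pointwise) — for EVERY square-integrable `g`, no summability involved;
* the EXACT CHAIN is less than twice worse: by the tree's weight-bound ceiling
  (`imhOp_tauInt_le_weightBound_of_sq`: summable series and `τ_int ≤ C/Z − ½` for every centred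
  `g ∈ L²(w)`), `σ²_chain(g) = 2τ_int Var ≤ (2C/Z − 1)·Var < 2·(C/Z)·Var = 2σ²_rej(g)`;
* and the chain CAN be unboundedly better than rejection sampling with the same (loose) envelope:
  for the perfect flow `q̃ = π` one has `τ_int = ½`, `σ²_chain = Var`, while `σ²_rej = (C/Z)Var` for
  any admissible `C ≥ Z` (remark; the perfect-flow identity is row 2's `FlowSamplerExact`, not restated).

Reading for S0-A (no numerics implied): with a certified envelope (e.g. a Gaussian minorant of the
flow, `Phi4FlowSamplerGaussianMinorant`, or the defensive mixture of GEN-24) all three uses have finite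
error bars for every square-integrable observable, ordered `σ²_RW ≤ σ²_chain < 2σ²_rej` and
`σ²_RW ≤ σ²_rej` per model draw; the chain's advantage over rejection sampling is that it needs NO
envelope constant to be run (only to be certified), rejection sampling's is independence.
NOT CLAIMED: the binomial-thinning CLT behind `σ²_rej` (interpretation only); cost beyond 'per model
draw'; any value of `C`, `Z`, `τ_int` for any network; that an envelope constant is available for a
given trained flow.

## What is proved (general `(X, μ)`; `w, q̃ > 0` measurable integrable, `∫ q̃ = 1`, `w ≤ C q̃`)

* **`reweightMoment_le_envelope`** — `g² w ∈ L¹ ⇒ g² b w ∈ L¹` and `∫ g² b w ≤ C ∫ g² w`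
  (`σ²_RW ≤ σ²_rej` after division by `Z²`);
* **`imhOp_chainVar_le_envelope_of_sq`** — centred `g ∈ L²(w)` with `∫ g² w > 0`: summable series and
  `2τ_int(g)·(∫g²w)/Z ≤ (2C/Z − 1)·(∫g²w)/Z`;
* **`imhOp_chainVar_lt_two_rejectionVar_of_sq`** — `… < 2·(C/Z)·(∫g²w)/Z`;
* lattice φ⁴ (`λ > 0`, real `J`, `f ∈ PolyObs`, any flow with an envelope `e^{−S} ≤ C q̃`):
  **`phi4Flow_reweightMoment_le_envelope`**, **`phi4Flow_chainVar_le_envelope_poly`**.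
-/

namespace Summit.Ventures.LatticeQCDFlow.Exactness

open Real MeasureTheory Filter Set
open Summit.Ventures.LatticeQCDFlow.Scoring

section General

variable {X : Type*} [MeasurableSpace X] {μ : Measure X} {w q : X → ℝ}

/-- **REWEIGHTING IS NEVER WORSE THAN REJECTION SAMPLING WITH THE SAME ENVELOPE**: `w ≤ C q̃`
pointwise (`q̃ > 0`), `g² w ∈ L¹` ⇒ `g² b w ∈ L¹` and `∫ g² b w ≤ C · ∫ g² w` (`b = w/q̃ ≤ C`). -/
theorem reweightMoment_le_envelope (hw0 : ∀ t, 0 < w t) (hwm : Measurable w) (hq0 : ∀ t, 0 < q t)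
    (hqm : Measurable q) {C : ℝ} (hC : ∀ t, w t ≤ C * q t) {g : X → ℝ} (hgm : Measurable g)
    (hg2 : Integrable (fun t => g t ^ 2 * w t) μ) :
    Integrable (fun x => g x ^ 2 * (w x / q x * w x)) μ ∧
    ∫ x, g x ^ 2 * (w x / q x * w x) ∂μ ≤ C * ∫ x, g x ^ 2 * w x ∂μ := by
  have hb : ∀ x, w x / q x ≤ C := fun x => (div_le_iff₀ (hq0 x)).2 (hC x)
  have h0 : ∀ x, 0 ≤ g x ^ 2 * (w x / q x * w x) := fun x =>
    mul_nonneg (sq_nonneg _) (mul_nonneg (div_pos (hw0 x) (hq0 x)).le (hw0 x).le)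
  have hpt : ∀ x, g x ^ 2 * (w x / q x * w x) ≤ C * (g x ^ 2 * w x) := fun x => by
    have hgw : 0 ≤ g x ^ 2 * w x := mul_nonneg (sq_nonneg _) (hw0 x).le
    have := mul_le_mul_of_nonneg_left (hb x) hgw
    nlinarith [this]
  have hint : Integrable (fun x => g x ^ 2 * (w x / q x * w x)) μ :=
    (hg2.const_mul C).mono' ((hgm.pow_const 2).mul ((hwm.div hqm).mul hwm)).aestronglyMeasurable
      (Eventually.of_forall fun x => by rw [Real.norm_eq_abs, abs_of_nonneg (h0 x)]; exact hpt x)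
  refine ⟨hint, ?_⟩
  calc ∫ x, g x ^ 2 * (w x / q x * w x) ∂μ ≤ ∫ x, C * (g x ^ 2 * w x) ∂μ :=
        integral_mono hint (hg2.const_mul C) hpt
    _ = C * ∫ x, g x ^ 2 * w x ∂μ := integral_const_mul _ _

variable [SFinite μ]

/-- **THE EXACT CHAIN IS AT MOST `(2C/Z − 1)` TIMES THE I.I.D. VARIANCE UNDER AN ENVELOPE**: `w ≤ C q̃`,
centred `g ∈ L²(w)` with `∫ g² w > 0`: the series is summable and
`2 τ_int(g) · (∫ g² w)/Z ≤ (2C/Z − 1) · (∫ g² w)/Z` (the tree's `τ_int ≤ C/Z − ½`). -/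
theorem imhOp_chainVar_le_envelope_of_sq (hw0 : ∀ t, 0 < w t) (hwm : Measurable w)
    (hwi : Integrable w μ) (hq0 : ∀ t, 0 < q t) (hqm : Measurable q) (hqi : Integrable q μ)
    (hq1 : ∫ z, q z ∂μ = 1) {C : ℝ} (hC : ∀ t, w t ≤ C * q t) {g : X → ℝ} (hgm : Measurable g)
    (hg2 : Integrable (fun t => g t ^ 2 * w t) μ) (hg0 : ∫ t, g t * w t ∂μ = 0)
    (hP : 0 < ∫ t, g t ^ 2 * w t ∂μ) :
    (Summable fun n => (∫ t, g t * ((imhOp μ w q)^[n + 1] g) t * w t ∂μ)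
      / ∫ t, g t ^ 2 * w t ∂μ) ∧
    2 * tauInt (fun n => (∫ t, g t * ((imhOp μ w q)^[n] g) t * w t ∂μ) / ∫ t, g t ^ 2 * w t ∂μ)
        * ((∫ t, g t ^ 2 * w t ∂μ) / ∫ z, w z ∂μ)
      ≤ (2 * C / (∫ z, w z ∂μ) - 1) * ((∫ t, g t ^ 2 * w t ∂μ) / ∫ z, w z ∂μ) := by
  obtain ⟨hs, hτ⟩ := imhOp_tauInt_le_weightBound_of_sq hw0 hwm hwi hq0 hqm hqi hq1 hC hgm hg2 hg0 hP
  refine ⟨hs, ?_⟩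
  have hZ : 0 < ∫ z, w z ∂μ := integral_pos_of_pos hw0 hwi hq1
  have hV0 : 0 ≤ (∫ t, g t ^ 2 * w t ∂μ) / ∫ z, w z ∂μ := div_nonneg hP.le hZ.le
  have e : 1 / ((∫ z, w z ∂μ) / C) = C / ∫ z, w z ∂μ := by rw [one_div_div]
  rw [e] at hτ
  have h2 : 2 * tauInt (fun n => (∫ t, g t * ((imhOp μ w q)^[n] g) t * w t ∂μ)
      / ∫ t, g t ^ 2 * w t ∂μ) ≤ 2 * C / (∫ z, w z ∂μ) - 1 := by
    rw [mul_div_assoc]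
    linarith
  exact mul_le_mul_of_nonneg_right h2 hV0

/-- **… HENCE LESS THAN TWICE THE REJECTION-SAMPLING BENCHMARK**: under the same hypotheses
`2 τ_int(g)·(∫g²w)/Z < 2·(C/Z)·(∫g²w)/Z` (`= 2σ²_rej(g)`). -/
theorem imhOp_chainVar_lt_two_rejectionVar_of_sq (hw0 : ∀ t, 0 < w t) (hwm : Measurable w)
    (hwi : Integrable w μ) (hq0 : ∀ t, 0 < q t) (hqm : Measurable q) (hqi : Integrable q μ)
    (hq1 : ∫ z, q z ∂μ = 1) {C : ℝ} (hC : ∀ t, w t ≤ C * q t) {g : X → ℝ} (hgm : Measurable g)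
    (hg2 : Integrable (fun t => g t ^ 2 * w t) μ) (hg0 : ∫ t, g t * w t ∂μ = 0)
    (hP : 0 < ∫ t, g t ^ 2 * w t ∂μ) :
    2 * tauInt (fun n => (∫ t, g t * ((imhOp μ w q)^[n] g) t * w t ∂μ) / ∫ t, g t ^ 2 * w t ∂μ)
        * ((∫ t, g t ^ 2 * w t ∂μ) / ∫ z, w z ∂μ)
      < 2 * (C / ∫ z, w z ∂μ) * ((∫ t, g t ^ 2 * w t ∂μ) / ∫ z, w z ∂μ) := by
  have h := (imhOp_chainVar_le_envelope_of_sq hw0 hwm hwi hq0 hqm hqi hq1 hC hgm hg2 hg0 hP).2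
  have hZ : 0 < ∫ z, w z ∂μ := integral_pos_of_pos hw0 hwi hq1
  have hV : 0 < (∫ t, g t ^ 2 * w t ∂μ) / ∫ z, w z ∂μ := div_pos hP hZ
  have hlt : (2 * C / (∫ z, w z ∂μ) - 1) * ((∫ t, g t ^ 2 * w t ∂μ) / ∫ z, w z ∂μ)
      < 2 * (C / ∫ z, w z ∂μ) * ((∫ t, g t ^ 2 * w t ∂μ) / ∫ z, w z ∂μ) := by
    have e : 2 * (C / ∫ z, w z ∂μ) = 2 * C / (∫ z, w z ∂μ) := by ring
    rw [e]
    nlinarith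
  exact h.trans_lt hlt

end General

/-! ## Lattice φ⁴ (`λ > 0`, real `J`, any flow with an envelope `e^{−S} ≤ C q̃`) -/

section Lattice

variable {n : ℕ}

/-- **Reweighting vs rejection sampling on lattice φ⁴**: for `f ∈ PolyObs` and any flow with
`e^{−S} ≤ C q̃`: `∫ (f−⟨f⟩)² b e^{−S} ≤ C · ∫ (f−⟨f⟩)² e^{−S}` (`σ²_RW(f) ≤ (C/Z)·Var(f)`). -/
theorem phi4Flow_reweightMoment_le_envelope {lam : ℝ} (hlam : 0 < lam)
    (J : Fin (n + 1) → Fin (n + 1) → ℝ) {q : (Fin (n + 1) → ℝ) → ℝ} (hq0 : ∀ φ, 0 < q φ)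
    (hqm : Measurable q) {C : ℝ} (hC : ∀ φ, gibbsWeight J lam φ ≤ C * q φ)
    {f : (Fin (n + 1) → ℝ) → ℝ} (hf : PolyObs f) :
    Integrable (fun φ => (f φ - gibbsExpect J lam f) ^ 2
      * (gibbsWeight J lam φ / q φ * gibbsWeight J lam φ)) ∧
    ∫ φ, (f φ - gibbsExpect J lam f) ^ 2 * (gibbsWeight J lam φ / q φ * gibbsWeight J lam φ)
      ≤ C * ∫ φ, (f φ - gibbsExpect J lam f) ^ 2 * gibbsWeight J lam φ := by
  obtain ⟨hgm, hg2⟩ := polyObs_sq_integrable hlam J (polyObs_sub_const hf (gibbsExpect J lam f))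
  exact reweightMoment_le_envelope (μ := volume) (fun φ => gibbsWeight_pos J lam φ)
    (continuous_gibbsWeight J lam).measurable hq0 hqm hC hgm hg2

/-- **The exact chain vs rejection sampling on lattice φ⁴**: `f ∈ PolyObs` with `Var f > 0`, any
flow with `e^{−S} ≤ C q̃`: summable series and `σ²_chain(f) ≤ (2C/Z − 1)·Var(f)` (`< 2σ²_rej(f)`). -/
theorem phi4Flow_chainVar_le_envelope_poly {lam : ℝ} (hlam : 0 < lam)
    (J : Fin (n + 1) → Fin (n + 1) → ℝ) {q : (Fin (n + 1) → ℝ) → ℝ} (hq0 : ∀ φ, 0 < q φ)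
    (hqm : Measurable q) (hqi : Integrable q) (hq1 : ∫ φ, q φ = 1) {C : ℝ}
    (hC : ∀ φ, gibbsWeight J lam φ ≤ C * q φ) {f : (Fin (n + 1) → ℝ) → ℝ} (hf : PolyObs f)
    (hP : 0 < ∫ φ, (f φ - gibbsExpect J lam f) ^ 2 * gibbsWeight J lam φ) :
    (Summable fun k => (∫ φ, (f φ - gibbsExpect J lam f)
        * ((imhOpPhi4 J lam q)^[k + 1] (fun ψ => f ψ - gibbsExpect J lam f)) φ * gibbsWeight J lam φ)
        / ∫ φ, (f φ - gibbsExpect J lam f) ^ 2 * gibbsWeight J lam φ) ∧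
    2 * tauInt (fun k => (∫ φ, (f φ - gibbsExpect J lam f)
          * ((imhOpPhi4 J lam q)^[k] (fun ψ => f ψ - gibbsExpect J lam f)) φ * gibbsWeight J lam φ)
          / ∫ φ, (f φ - gibbsExpect J lam f) ^ 2 * gibbsWeight J lam φ)
        * ((∫ φ, (f φ - gibbsExpect J lam f) ^ 2 * gibbsWeight J lam φ) / gibbsZ J lam)
      ≤ (2 * C / gibbsZ J lam - 1)
        * ((∫ φ, (f φ - gibbsExpect J lam f) ^ 2 * gibbsWeight J lam φ) / gibbsZ J lam) := by
  obtain ⟨hgm, hg2⟩ := polyObs_sq_integrable hlam J (polyObs_sub_const hf (gibbsExpect J lam f))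
  have hg0 := integral_polyObs_sub_gibbsExpect hlam J hf
  rw [imhOpPhi4_eq_imhOp]
  exact imhOp_chainVar_le_envelope_of_sq (μ := volume) (fun φ => gibbsWeight_pos J lam φ)
    (continuous_gibbsWeight J lam).measurable (integrable_gibbsWeight hlam J) hq0 hqm hqi hq1 hC hgm
    hg2 hg0 hP

end Lattice

end Summit.Ventures.LatticeQCDFlow.Exactness
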